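import Summits.QuantumFields.YangMills.Theorems.SwapVirialDeficitBlowUpPeriodicTwoScalePositive
import HarnessLib

/-!
# The PERIODIC massive-mode rung, brick PM-VI: MEASURABILITY of the two-scale limit profile `a ↦ M a = (vol³⊗vol^{Fol})(W ∩ {ξ | (a, ξ) ∈ E})`
# (free-hands support of ⟨stmt-QuantumFields-24196⟩ `SwapVirialDeficit.ToronSoftnessSharp`; the `Measurable M` input of ✓`relativeGap_fixedL_of_twoScaleLimit[_level]` /
# LEAD ym-line-sfw-p2 g96's a₀-averaged (A))

★ `measurable_measure_window_section`: for a measurable window `W ⊆ Ξ` and a measurable `E ⊆ ℝ × Ξ`, `a ↦ μ(W ∩ {ξ | (a, ξ) ∈ E})` is measurable (Mathlib's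
`measurable_measure_prodMk_left`).  ★ `isOpen_sliceGood_phi_lt` / `measurableSet_sliceGood_phi_lt`: the natural `E = {(a, ξ) | (a, ξ) ∈ sliceGood ∧ Φ(0,0;a,ξ) < r}` is OPEN
(✓`continuousOn_twoScalePhi` on the open ✓`sliceGood`), hence measurable; so `M a := μ(W₀ ∩ {ξ | (a,ξ) ∈ sliceGood ∧ Φ(0,0;a,ξ) < r})` is measurable (★ `measurable_twoScaleProfile`).
HONEST LABEL: plumbing for a plan-level fixed-`L` rung of a DRAFT line; ⟨24196⟩/⟨24497⟩ OPEN; own crux ⟨22884⟩ OPEN (blocked-on ⟨19935⟩); the Yang–Mills mass gap is NOT proved;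
no summit is proved by a line.  Width seat ym-line-sfw-p2-w3 g64 (cell ym-idea-1, free hands), `--supports stmt-QuantumFields-24196`.  THEOREMS ONLY (0 `def`, 0 `sorry`),
standard axioms.  References: [cite: Luscher1983, §2]; [folklore].
-/

set_option autoImplicit false

noncomputable section

open MeasureTheory Quaternion Set Filter Topology
open scoped Quaternion ENNReal
open Literature.MathematicalPhysics.QuantumLattice
open Literature.MathematicalPhysics.QuantumFieldTheory hiding SU2
open Summit.QuantumFields.YangMills.Theorems.SwapTwistDeficit.ToronLog

attribute [local instance] Literature.Analysis.FluidPDE.Tao2016.quatMeasurableSpace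
  Literature.Analysis.FluidPDE.Tao2016.quatBorelSpace
  Literature.MathematicalPhysics.QuantumLattice.secondCountableTopology_su2

namespace Summit.QuantumFields.YangMills.Theorems.SwapVirialDeficit.BlowUpRing

open Summit.QuantumFields.YangMills.Theorems.FemtoTransferGap
open Summit.QuantumFields.YangMills.Theorems.FemtoTransferGap.TT

variable {L : ℕ} [NeZero L]

/-- ★ Sections of a measurable set cut by a fixed measurable window have measurable measure in the parameter. [folklore] -/
theorem measurable_measure_window_section {Ξ : Type*} [MeasurableSpace Ξ] (μ : Measure Ξ) [SFinite μ] {W : Set Ξ} (hW : MeasurableSet W)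
    {E : Set (ℝ × Ξ)} (hE : MeasurableSet E) : Measurable fun a : ℝ => μ (W ∩ {ξ | (a, ξ) ∈ E}) := by
  have hE' : MeasurableSet ((Set.univ ×ˢ W) ∩ E) := (MeasurableSet.univ.prod hW).inter hE
  have h := measurable_measure_prodMk_left (ν := μ) hE'
  have hset : ∀ a : ℝ, Prod.mk a ⁻¹' ((Set.univ ×ˢ W) ∩ E) = W ∩ {ξ | (a, ξ) ∈ E} := fun a => by
    ext ξ; simp
  simpa only [hset] using h

/-- ★ The natural limit-profile set `{(a, ξ) | (a, ξ) ∈ sliceGood ∧ Φ(0,0;a,ξ) < r}` is open. [folklore] -/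
theorem isOpen_sliceGood_phi_lt (r : ℝ) :
    IsOpen {p : ℝ × ((ℍ × ℍ) × ℍ) × (Fol L → ℍ) | p ∈ sliceGood L ∧ twoScalePhi L 0 0 p.1 p.2.1 p.2.2 < r} := by
  have hι : Continuous fun p : ℝ × ((ℍ × ℍ) × ℍ) × (Fol L → ℍ) => (((0 : ℝ), (0 : ℝ), p) : TwoScaleParam L) :=
    continuous_const.prodMk (continuous_const.prodMk continuous_id)
  have hcont : ContinuousOn (fun p : ℝ × ((ℍ × ℍ) × ℍ) × (Fol L → ℍ) => twoScalePhi L 0 0 p.1 p.2.1 p.2.2) (sliceGood L) := by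
    have e : (fun p : ℝ × ((ℍ × ℍ) × ℍ) × (Fol L → ℍ) => twoScalePhi L 0 0 p.1 p.2.1 p.2.2) =
        (fun q : TwoScaleParam L => twoScalePhi L q.1 q.2.1 q.2.2.1 q.2.2.2.1 q.2.2.2.2) ∘
          (fun p : ℝ × ((ℍ × ℍ) × ℍ) × (Fol L → ℍ) => (((0 : ℝ), (0 : ℝ), p) : TwoScaleParam L)) := rfl
    rw [e]
    exact continuousOn_twoScalePhi.comp hι.continuousOn fun p hp => hp
  exact hcont.isOpen_inter_preimage isOpen_sliceGood isOpen_Iio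

/-- The same set is measurable. [folklore] -/
theorem measurableSet_sliceGood_phi_lt (r : ℝ) :
    MeasurableSet {p : ℝ × ((ℍ × ℍ) × ℍ) × (Fol L → ℍ) | p ∈ sliceGood L ∧ twoScalePhi L 0 0 p.1 p.2.1 p.2.2 < r} := by
  haveI : OpensMeasurableSpace (ℝ × (((ℍ × ℍ) × ℍ) × (Fol L → ℍ))) := Prod.opensMeasurableSpace
  exact (isOpen_sliceGood_phi_lt r).measurableSet

/-- ★ **`M` IS MEASURABLE**: `a ↦ (vol³⊗vol^{Fol})(W₀ ∩ {ξ | (a, ξ) ∈ sliceGood ∧ Φ(0,0;a,ξ) < r})` is measurable, for the frozen window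
`W₀ = {((|x₀|<1 ∧ |y′₀|<1) ∧ |z₀|<1) ∧ ∀ f, |re y_f|<1}`. [folklore] -/
theorem measurable_twoScaleProfile (r : ℝ) :
    Measurable fun a : ℝ => ((volume : Measure ((ℍ × ℍ) × ℍ)).prod (Measure.pi fun _ : Fol L => (volume : Measure ℍ)))
      ({ξ : ((ℍ × ℍ) × ℍ) × (Fol L → ℍ) | ((|ξ.1.1.1.re| < 1 ∧ |ξ.1.1.2.re| < 1) ∧ |ξ.1.2.re| < 1) ∧ ∀ i, |(ξ.2 i).re| < 1} ∩
        {ξ | ((a, ξ) : ℝ × ((ℍ × ℍ) × ℍ) × (Fol L → ℍ)) ∈ sliceGood L ∧ twoScalePhi L 0 0 a ξ.1 ξ.2 < r}) := by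
  have hW : MeasurableSet {ξ : ((ℍ × ℍ) × ℍ) × (Fol L → ℍ) | ((|ξ.1.1.1.re| < 1 ∧ |ξ.1.1.2.re| < 1) ∧ |ξ.1.2.re| < 1) ∧ ∀ i, |(ξ.2 i).re| < 1} := by
    have hre : Measurable fun v : ℍ => |v.re| := Quaternion.continuous_re.measurable.abs
    refine ((((measurableSet_lt (hre.comp (measurable_fst.comp (measurable_fst.comp measurable_fst))) measurable_const).inter
      (measurableSet_lt (hre.comp (measurable_snd.comp (measurable_fst.comp measurable_fst))) measurable_const)).inter
      (measurableSet_lt (hre.comp (measurable_snd.comp measurable_fst)) measurable_const)).inter ?_)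
    show MeasurableSet {ξ : ((ℍ × ℍ) × ℍ) × (Fol L → ℍ) | ∀ i, |(ξ.2 i).re| < 1}
    rw [Set.setOf_forall]
    exact MeasurableSet.iInter fun i => measurableSet_lt (hre.comp ((measurable_pi_apply i).comp measurable_snd)) measurable_const
  haveI : SFinite ((volume : Measure ((ℍ × ℍ) × ℍ)).prod (Measure.pi fun _ : Fol L => (volume : Measure ℍ))) := Measure.prod.instSFinite
  exact measurable_measure_window_section _ hW (measurableSet_sliceGood_phi_lt (L := L) r)

end Summit.QuantumFields.YangMills.Theorems.SwapVirialDeficit.BlowUpRing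

end
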